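/-
Copyright: pub-balaban β-flow team, STATEMENT-EXACT TYPER (unit `b2b-balaban-beta-asprinted`; coordinator asks «YM
ACCELERATION» 2026-08-21 item (2) and «CMP109-FIDELITY» (d): «SMALL-FIELD FLOW = VERBATIM-IN-PRINT, to be typed as printed …
a second as-printed file»).  A statement-level record of a published text: the β-functions and the coupling-constant
renormalization of Bałaban, Commun. Math. Phys. 109 (1987) = «[I]», typed AS PRINTED as one predicate on a carrier of the
printed objects — every printed hypothesis a named binder, every printed definition ∕ claim a named conjunct, in the order
the text introduces them — OVER the tree's B12 records (no record re-typed).  NOTHING is proved here about [I]'s objects.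
-/
import Mathlib
import Literature.MathematicalPhysics.QuantumFieldTheory.Balaban1983to89.B12Sec2to5
import Literature.MathematicalPhysics.QuantumFieldTheory.Balaban1983to89.B12Rep537
import Literature.MathematicalPhysics.QuantumFieldTheory.Balaban1983to89.FlowStep
import Literature.MathematicalPhysics.QuantumFieldTheory.Balaban1983to89.B12CouplingClausesHistory
import Literature.MathematicalPhysics.QuantumFieldTheory.BalabanJaffe1986.BJ86EffectiveAction

/-!
# `Balaban1983to89.B12BetaAsPrinted` — the β-functions and the coupling-constant renormalization of T. Bałaban,
*Renormalization group approach to lattice gauge field theories. I. Generation of effective actions in a small field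
approximation and a coupling constant renormalization in four dimensions*, Commun. Math. Phys. **109** (1987) 249–301
[Balaban1987RG1] (cell paper B12 = «[I]»), EXACTLY AS PRINTED: (0.18)∕(0.20)∕(2.15) (the recursion), (1.3)∕(1.6) (where the
β-terms sit), (1.20)–(1.22) and (5.42) (the definition of β_{j+1}(g_j)), (1.7)∕(1.18), Theorem 3 (p. 264) with its
hypothesis list and the β-clause of p. 264 inside its conclusion, (5.10), (5.37)–(5.38) with (5.44); Theorem 2 (p. 259) as a
POINTER to the tree's single typing.

statement-level skeleton of published theorems with citation tags; proofs where landed; nothing here is a claim about the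
Yang–Mills mass gap

CITATION HEADER (lean-in-tree rule 2026-08-18).  PDF held: `paper:balaban1987-cmp109-rg-i-small-field` (journal page = PDF
page + 248).  Every sentence quoted below was read by this seat on the page images `run/shared/lean/pub/pub-balaban/
b2b-balaban-ref1/pages/1987-cmp109-rg-I-small-field/…-p003∕p007∕p008∕p011∕p012∕p013∕p015∕p016∕p018∕p019∕p020∕p021∕p044∕p045∕
p049∕p050-x2.png` (pp. 251, 255–256, 259–261, 263–264, 266–269, 292–293, 297–298); «tl.nn» = line of the text-layer file
`p00NN.txt` of `lit read paper:balaban1987-cmp109-rg-i-small-field` (running head = tl.1; displays are garbled there and are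
located by their printed number).  Deferral locus outside [I]: T. Bałaban, *Large field renormalization. II*, Commun. Math.
Phys. **122** (1989) 355–392 [Balaban1989LargeFieldII] p. 355, read on `lit read paper:balaban1989-cmp122-large-field-ii` p. 1
tl.24–30.  Fidelity ledger (DEFINED ∕ PROOF ∕ STATED per item, two independent readers + countersign): `run/shared/lean/pub/
pub-balaban/beta/CMP109-FIDELITY.md` v1.5 (§4.1 V1–V5 is the list typed here); interface needs of BINDER row D4:
`…/INBOX.md` l.12733 (N-D4-1…5); the places where THIS typing had to choose a reading the print leaves open, or carries a
printed sentence as an abstract slot: `…/beta/asprinted/DELTA-I.md`.  `[sic]` marks printed slips; nothing inside a quotation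
is repaired.  Companion (the Erice form of the same programme): `BalabanJaffe1986.BetaFlowAsPrinted`.

## What is printed, and in what form (verbatim; p. = journal page)

* p. 251 tl.21–23: *"We take L_μ = L^m, where L is an odd, positive integer > 11, and m is a positive integer."*; tl.18–19:
  *"The analysis of the Callan-Symanzik equations, based on perturbative calculations, will be discussed in another paper."*;
  last line: *"We assume that G is semisimple and"* (continued p. 252).
* p. 255 (0.18) and tl.22–26: *"The action A₁ determines a function β₁(g₀) of the bare coupling constant g₀, defined on an
  interval [0, γ], γ > 0. This is a function in a sequence of β-functions. In the next section we will relate them to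
  effective actions. Now we assume the existence of the first function, and we define the new coupling constant g₁
  1∕g₀² = 1∕g₁² + β₁(g₀), or 1∕g₁² = 1∕g₀² − β₁(g₀). (0.18)"*; p. 256 tl.2–4: *"and the coupling constant g_{k+1} is determined
  from the equation 1∕g_k² = 1∕g²_{k+1} + β_{k+1}(g_k). (0.20)"*; tl.7–10: *"We continue the calculation of the effective actions
  until we reach the unit lattice … Let us denote the corresponding index by K, hence ε = L^{−K}, and the sequence of actions
  and coupling constants is defined for k = 0, 1, …, K."*; tl.33: *"The function 𝐄_k depends also on the effective coupling
  constants g₀, …, g_{k−1}."*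
* p. 259, Theorem 1: *"If the sequence of the effective coupling constants is contained in an interval ]0, γ] with a
  sufficiently small positive γ, then the effective actions for small fields are given by the formulas (0.22)–(0.24), with
  terms satisfying (0.29)."*; then: *"It is interesting to notice that we do not assume any special asymptotic behavior of
  the coupling constants, like asymptotic freedom."*; scope: *"The above theorem will be reformulated more elaborately in the
  next section. It will be proved in this paper for an arbitrary semisimple compact Lie group G ⊂ U(N), and for d = 4. The
  proof also covers the dimension d = 3, but in that case it is not necessary to consider the β-functions and the
  renormalization group equations (0.18), (0.20). … The problem of whether the assumption is satisfied in dimension d = 4 is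
  addressed in the next theorem."*; Theorem 2 and (0.31): see `Theorem2Statement`; last lines: *"A proof of this theorem,
  based on perturbative calculations, will be given in a separate paper, where more precise asymptotic behavior will be
  proved."* (p. 260 tl.2–3: *"The restriction to the group SU(2) is superficial and is done only to simplify calculations."*)
* p. 260 (1.3): *"A_k(U_k) = −(1∕g_k²)A(U_k) + Σ_{j=0}^{k−1}{−β_{j+1}(g_j)A(U_k) + [log Z^{(j)}(U_k) − log Z^{(j)}(1)] +
  [𝐄^{(j+1)}(g_j, U_k) − 𝐄^{(j+k)} [sic] (g_j, 1)]}. (1.3) We have written explicitly terms of the order 0 in the coupling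
  constants."*; p. 261: *"In many considerations it is not necessary to separate the terms of zeroth order from the remaining
  terms in the interaction, and then we write A_k(U_k) = −(1∕g_k²)A(U_k) + Σ_{j=0}^{k−1}{−β_{j+1}(g_j)A(U_k) + [𝐄^{(j+1)}(g_j, U_k)
  − 𝐄^{(j+1)}(g_j, 1)]}. (1.6)"* and *"We assume that it has the representation 𝐄^{(j)}(g_{j−1}, U_j) = Σ_{X∈𝐃_j} 𝐄^{(j)}(X,
  g_{j−1}, U_j). (1.7) … We can assume that this representation holds for the functions 𝐄^{(j)} in (1.3) and (1.6)"*.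
* p. 263 tl.22–31: *"We assume that the function 𝐄^{(j)}(X, g_{j−1}, 𝐔, 𝐉) is defined and analytic on the space U^c_j(X, α₀,
  α₁), with some positive, absolute constants α₀, α₁ (i.e., constants independent of X and j). It depends on the
  configurations restricted to X, i.e. on (𝐔, 𝐉)|_X. It is a C^∞-function of g_{j−1} ∈ [0, γ], (or analytic), with a positive,
  absolute γ. There exists a constant E₀ such that |𝐄^{(j)}(X, g_{j−1}, 𝐔, 𝐉)| ≦ E₀ exp(−κd_j(X)) (1.18) for M ≧ M(κ), γ
  sufficiently small, and for all configurations (𝐔, 𝐉) ∈ U^c_j(X, α₀, α₁)."*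
* p. 264 tl.1–28 ((1.20)–(1.22), the β-clause, Theorem 3): quoted in full at `Setting.pol`, `Definitions`, `Conclusions`.
* p. 266 tl.32–37: *"Another possibility is to take g_k∕γ_kε₁ instead of ε₁, where γ_k = C log(L^kε)^{−1} with C sufficiently
  large. It has the advantage that the functions 𝐄^{(j)}, β_j are analytic functions of the effective coupling constants, but
  it has some disadvantages in perturbative calculations also. We have formulated the implications of both possibilities in
  the inductive description."*
* p. 268 (2.13)–(2.15) and tl.20–31: quoted at `Definitions`; p. 269 tl.24–27: *"Thus the proof of Theorem 3 is reduced to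
  proving the remaining properties of (2.13), i.e. to a construction of the representation (1.7) with terms having the
  analytic extensions satisfying the bound (1.18)."*; p. 298 tl.18–21: *"In the next paper we will construct such
  localizations and prove the bounds. They are used … to finish the proof of the inductive assumptions for the term 𝐄^{(k+1)}
  defined by (2.13)."* ([Balaban1988RG2Cluster] p. 22: completes the proof of Theorem I.3).
* p. 292 (5.1), p. 293 (5.7)–(5.10), p. 297 (5.37)–(5.38), (5.42), (5.44), p. 298 tl.5 and tl.37–39: quoted at
  `Conclusions` ∕ `Definitions`; p. 298 tl.37–39: *"We write β_j as explicitly dependent on g_{j−1}, although it depends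
  also on all preceding coupling constants. The dependence on g_{j−1} is important and it determines main properties of the
  renormalization group equations."*
* [Balaban1989LargeFieldII] p. 355: *"Theorem 2 of [I] allows us to remove the assumption on the effective coupling
  constants in the above theorem, because this assumption follows from the basic inequality (0.31) [II] [sic], which is the
  result of Theorem 2. The proof of Theorem 2, which is based on second order perturbative calculations, is very awkward and
  long in the context of the renormalization group approach to lattice gauge field theories, and has not been published yet,
  so we have Theorem 1 with the assumption."*

WHAT [I] PROVES ABOUT β AND WHAT IT DOES NOT (fidelity ledger §0, two readers + countersign, 0 dissents): DEFINED — β by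
(1.20)–(1.22)∕(5.42), the recursion (0.18)∕(0.20)∕(2.15); PROVED in [I]+[II] UNDER THE HYPOTHESIS H_γ «0 < g_k ≦ γ, k = 0,
…, K» and for the small-field transformations only — the structure (5.37)–(5.38) with (5.44) given the decay (5.10), hence
the uniform boundedness of β_{j+1} (one undisplayed line: `beta_abs_le_of_decay510` below), and Theorem 3 (the inductive
assumptions incl. the β-clause of p. 264; all-derivative smoothness certified inside Theorem 3's bundle, no isolated display);
NOT PROVED anywhere in print — Theorem 2 (sign ∕ size of β, (0.31), the tuning g₀(ε, g)): [I] p. 251, p. 259, p. 264 defer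
it, [Balaban1989LargeFieldII] p. 355 «has not been published yet».

## What is typed, and how

* `Setting` — the printed OBJECTS (fields in the order of first appearance in print, page in each field's docstring): L;
  the group sentence (slot); the runs (g_k)_{k ≤ K} indexed by the tree's `B12.RunParams` = (K, m, g₀); the β-functions as a
  HISTORY-DEPENDENT family `FlowStep.HBeta` (p. 256 tl.33, p. 298 tl.37–39; index shift `β j p = β_{j+1}(g₀, …, g_j)`); the
  constants of Theorem 3 as letters (ε₀, γ, M, κ, α₀, α₁, M(·), κ₀, ε₁, each at its first page); the cut-off alternative of
  p. 266 (a flag, it decides the «(or analytic)» of pp. 263–264); the configurations at each step (abstract) with the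
  configuration 1; the THREE TERM SLOTS of (1.3)∕(1.6) — `logZ` (zeroth order), `Eint` (= 𝐄^{(j+1)}(g_j, ·) of (1.3)), `Ebold` (= 𝐄^{(j+1)}(g_j, ·) of (1.6))
  — row-D4 need N-D4-1; the representation-with-bound predicate of (1.7)∕(1.18)∕(4.37) as a SLOT `repr437 j F E` with the
  constant E A BINDER (N-D4-3) and the printed constant E₀; the polarization-after-the-limit operator `pol j` of
  (1.20)–(1.21)∕(5.1) (abstract: the tree's finite-volume body is `B12PolarizationTensor120.polTensor`, the limit
  `B12Limit51`) and the kernels Π_{j+1,μν}(g_j, ·) on ℤ⁴ (`B12Beta.Kernel 4`; d = 4 by p. 259 ∕ Theorem 2); log N″_k of (2.14);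
  Theorem 3's conclusion «all the inductive assumptions described between (1.1)–(1.22)» as a SLOT `indAss` (content = the
  cell's `Step` ∕ `B12StepObligation` ∕ `B12Thm3Assembly`, not re-typed); the constants δ₀, δ₁, O(1) of (5.10) and O(1) of
  (5.44).
* `StandingHypotheses S` — p. 251's conditions on L and G and THEOREM 3's HYPOTHESES ON THE CONSTANTS, one binder each,
  printed order («positive constants κ₀, M(κ), γ, ε₀, ε₁, α₀, α₁ … if κ ≧ κ₀, M ≧ M(κ)»).  Theorem 3's hypothesis ON THE RUN
  — «the sequence of actions A_k, defined inductively by the small field renormalization transformations (0.17)–(0.20)» with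
  «0 < g_k ≦ γ for k = 0, 1, …, K» (H_γ) — is `RunHyp S P` := the tree's `FlowStep.RGEqH P.K S.β (S.cpl P)` ((0.20) along the
  run) ∧ `Step.InInterval S.γ P.K (S.cpl P)`, and stands as the ANTECEDENT of every run-level conclusion (a condition on a
  run, not on the setting).  The printed quantifier shell over the constants
  («There exist … such, that if …»; «ε₀, ε₁, α₀, α₁ depend on M»; «γ depends on all other constants») is the tree's
  `B12.Thm3Printed` (by name; `B12Thm3Assembly.thm3Printed_iff_schedule`) and is not re-typed on this fixed-letter carrier.
* `Definitions S` — (0.18) bare end; (0.20)∕(2.15) «g_{k+1} is determined from the equation (0.20)» in the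
  forward-determination form of `FlowStep.B12Thm2Shape_of_betaBoundsH`'s `hfwd` (whenever the right side is positive, g_{k+1}
  is its positive solution — NOT the bare equation for every (K, m, g₀), which print does not assert for runs that do not
  exist); (1.3) = (1.6) (the split, N-D4-1); p. 268 tl.23 (the interaction slot at g_k = 0 is coupling-free, N-D4-2) and
  (2.14); (1.20)–(1.21) (kernel = pol of 𝐄^{(j+1)}, the BOOKKEEPING consequence pol 𝐄 = pol log Z + pol 𝐄_int of (1.3)∕(1.6),
  and the symmetries (1.21)₂ in their ℤ⁴ form (5.6)–(5.8)); (1.22) = (5.42) (both printed equalities, via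
  `BJ86EffectiveAction.fourierT ∕ mixedDeriv0` and `B12Beta.secondMoment`, on the printed coupling domain `histDom`).
* `Conclusions S` — for every run satisfying `RunHyp`: Theorem 3's conclusion (slot) for k ≤ K; its β-items spelled out at
  every step j + 1 ≤ K, for the run's own history (g₀, …, g_{j−1}) and EVERY value of the last coupling in [0, γ] (p. 263 «of
  g_{j−1} ∈ [0, γ]», p. 264 «defined on the interval [0, γ]»): (1.7) + (1.18) for the two 𝐄-slots with the printed E₀ (p. 261
  «for the functions 𝐄^{(j)} in (1.3) and (1.6)»); the β-clause of p. 264 AS PRINTED — per j, no lettered constant, no j- or history-uniformity (N-D4-4; the uniform readings are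
  `B12CouplingClausesHistory.BetaDerivsUniformInLast264`, `BetaDerivClause.LastVarDerivBound`), and in the LAST coupling only, as
  pp. 263–264 formulate it — no regularity of β_{j+1} in the preceding couplings g₀, …, g_{j−1} is a conjunct (none is printed
  for the cut-off (2.9); p. 266's sentence on the alternative cut-off is typed by name elsewhere; DELTA-I D-20, and «NOT typed
  here» below); then §5: (5.10) as the SCHEMA
  «representation (4.37) with (1.18)-type constant E ⟹ decay with O(1)·E» (N-D4-3; print displays the instance 𝐄^{(j)}, E₀);
  (5.37)–(5.38) with the coefficient β = β_{j+1}(g₀, …, g_j) (p. 298 tl.5 «Defining the function β_j as equal to the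
  coefficient β in (5.43)») and (5.44), on the complex coefficient carrier of `B12Rep537` (`wilsonQ` = the kernel with symbol
  δ_{μν}Δ(p) − ∂̄_μ(p)∂_ν(p), `genFun_wilsonQ`).  ORIENTATION, carried [sic] (DELTA-I D-18): read with print's own (5.11)
  «Π̃_{μν}(p) = Σ_x e^{−ip·x}Π_{μν}(x)» and (5.15) «∂_μ(ζ) = e^{iζ_μ} − 1», the marginal printed in (5.16)∕(5.36)∕(5.37),
  δ_{μν}Δ(p) − ∂̄_μ(p)∂_ν(p) (position kernel `wilsonQ μ ν`, typed LITERALLY in `Conclusions.c537`), is for μ ≠ ν the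
  νμ-TRANSPOSE (p ↦ −p) of the quadratic form selected by print's reflections (5.7)∕(5.13) and transversality (5.9)∕(5.15)
  (position kernel `wilsonQ ν μ`): Σ_μ ∂_μ(−p)[δ_{μν}Δ − ∂_μ∂̄_ν] = Σ_ν ∂_ν(p)[δ_{μν}Δ − ∂_μ∂̄_ν] = 0, whereas
  Σ_μ ∂_μ(−p)[δ_{μν}Δ − ∂̄_μ∂_ν] = ∂̄_νΔ − (Σ_μ ∂̄_μ²)∂_ν ≢ 0 (∂̄_μ(p) = ∂_μ(−p); e.g. e^{ip} = (i, −1, 1, 1), ν = 1), and for each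
  μ ≠ ν the kernel `wilsonQ μ ν` fails (5.7)'s clause at ε = −1 in direction ν only, z = 0.  Consequently the typed remainder
  Σ_w D_w Π′_w of `c537` does NOT inherit `Definitions.d121`'s reflection clause when β_{j+1} ≠ 0, and p. 297's *"The function Π′_{μν}(p) has all the symmetries of
  the function Π_{μν}(p)"* — quoted at `c537`, deliberately NOT a conjunct — holds for the (5.7)-oriented split Π − β·Qᵀ
  only.  β-BLIND: (1.22)∕(5.42) (`d122`) read moments of order ≤ 2, which Q and Qᵀ share (Q − Qᵀ is of third order in the
  lattice derivatives); `beta_abs_le_of_conclusions` and every consumer of β are unaffected.  Kernel certificates of both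
  facts live on the Summits side (by name: `EriceFlowEnclosureB12AsPrintedMarginal.wilsonQ_not_reflect` ∕
  `wilsonQ_transpose_reflect` ∕ `crossQ_sub_transpose`, `EriceFlowEnclosureB12AsPrintedOrientation.remainder537_not_reflect` ∕
  `transposedRemainder537_reflect`); as everywhere in this file, nothing inside a quotation or a field is repaired.
* `B12BetaAsPrinted S : Prop := StandingHypotheses S → Definitions S → Conclusions S` — a PREDICATE on settings (as
  `BetaFlowAsPrinted`, `B12.Thm3Printed`); NOT asserted for any setting, never a `theorem`.
* `Theorem2Statement S hL` — Theorem 2 ∕ (0.31) BY NAME: the tree holds ONE Theorem-2 typing under three names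
  (`B12.Thm2Printed` ≃ `Missing.B12Thm2Shape` ≃ `B16.Thm2Shape`, `B12Thm2Bridge.thm2Printed_iff_missing`); here it is
  instantiated at this setting's run family (`flowOf`).  STATED WITHOUT PROOF in print; never a conjunct of `Conclusions`.
* Dictionary (kernel-checked, a few lines each): `beta_abs_le_of_decay510` and `beta_abs_le_of_conclusions` (|β_{j+1}| bounded
  on [0, γ] uniformly in j from the (5.10)-schema + (1.18) + (1.22) — the undisplayed line of CMP109-FIDELITY §2.2, composed
  on the interface by name); `smooth264_of_box`, `analytic264_of_box`, `derivBound264_of_box` (the history-UNIFORM-IN-THE-BOX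
  schemata of `B12CouplingClausesHistory` imply the as-printed per-run clauses); `pol_Eint_eq_of_lastZero` (N-D4-2 at kernel
  level); `hL_of_standing` (the side condition of `Theorem2Statement`).

NOT typed here (reasons in `DELTA-I.md`): Theorem 1 (p. 259; = `B12.Thm1Printed`, «a precise version» is Theorem 3); the
C^∞ clause of p. 263 for the LOCALIZED terms (tree `B12BetaSmooth.ESmoothHyp`, `B12CouplingClausesHistory.SmoothInLast263`;
this carrier holds no localized terms); the finite-volume tensor (1.20) with its body and the limit T^{(j+1)} ↗ ℤ^d (tree
`B12PolarizationTensor120`, `B12Limit51`); (5.11)–(5.36) (the derivation; tree `B12Rep537`, `B12Sec5Algebra`,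
`B12LaurentSplit522`); any sign, lower bound, value at 0 or asymptotics of β (none is printed in [I]); any regularity
(continuity, smoothness, analyticity) of β_{j+1} in the PRECEDING couplings g₀, …, g_{j−1} (DELTA-I D-20): for the cut-off (2.9)
[I] prints none — p. 263 *"C^∞-function of g_{j−1} ∈ [0, γ]"* (of 𝐄^{(j)}) and p. 264 *"defined on the interval [0, γ]"* (of
β_{j+1}(g_j)) speak of the last coupling, p. 298 tl.37–39 *"although it depends also on all preceding coupling constants"* states
the dependence and attributes no regularity to it —; for the p. 266 alternative there is the one sentence *"the functions 𝐄^{(j)},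
β_j are analytic functions of the effective coupling constants"* (tl.32–37), whose implications print says it has *"formulated …
in the inductive description"*, i.e. as the «(or analytic)» of pp. 263–264 — the last-variable member of `Conclusions.c264` under the flag `altCutoff266` —, and
whose JOINT reading (β_{k+1} real-analytic on [0, γ]^{k+1}) is the tree's hypothesis schema
`B12CouplingClausesHistory.BetaAnalyticInCouplings266`, by name, not a conjunct here (it implies the last-variable member:
`analytic264_of_box (B12CouplingClausesHistory.betaAnalyticInLast264_of_couplings h) hI hj`).  The cell's Theorem-2 reductions on
this carrier all add the joint-continuity letter `FlowStep.BetaContH γ S.β` («(C)»: β_{k+1} continuous on ]0, γ]^{k+1}); that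
letter is certified NOT derivable from `StandingHypotheses ∧ Definitions ∧ Conclusions` with the flag ON together with every
last-variable schema and `FlowStep.BetaPertH`, and LOAD-BEARING for `Theorem2Statement`
(`EriceFlowEnclosureB12AsPrintedHistoryJumpEnd.asPrinted_allLetters_not_theorem2` ∕ `histCont_loadBearing`, Summits side,
β-flow prover 1, 2026-08-27), while the joint reading of p. 266 supplies it (`B12CouplingClausesHistory.betaContH_of_analyticInCouplings266`,
`…HistoryJumpEnd.theorem2Statement_of_pertH_of_couplings266`).  As with D-19's letters, nothing to change in an as-printed
file: the letter is the consumers'.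
-/

open scoped BigOperators

namespace Literature.MathematicalPhysics.QuantumFieldTheory.Balaban1983to89

open Literature.MathematicalPhysics.QuantumFieldTheory.GawedzkiKupiainen1985.PeriodicGleason (Pt delta ExpBound)
open Literature.MathematicalPhysics.QuantumFieldTheory.BalabanJaffe1986.BJ86EffectiveAction (fourierT mixedDeriv0)
open FlowStep (HBeta prefixOf Box)

noncomputable section

namespace B12BetaAsPrinted

/-- The carrier of the printed objects of [Balaban1987RG1] on which the β-function statements are made; fields in the
order of FIRST APPEARANCE in print (journal page in parentheses); see the module docstring for the sentence behind each field.
`L` (251); `groupScope` (251–252, 259, 260: SLOT carrying *"We assume that G is semisimple"*, *"proved … for an arbitrary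
semisimple compact Lie group G ⊂ U(N), and for d = 4"*, Theorem 2's *"G = SU(2) … superficial"*); `ε₀` (254 tl.22 *"with ε₀
positive"*, (0.16), (1.2)); `cpl P k` = g_k of the run with parameters `P = ⟨K, m, g₀⟩` (255–256: bare coupling g₀, ε = L^{−K},
L_μ = L^m; `B12.RunParams`); `β j p` = β_{j+1}(g₀, …, g_j), `p : Fin (j+1) → ℝ` the coupling history (255 (0.18), 256 tl.33,
298 tl.37–39; `FlowStep.HBeta`); `γ` (255: β₁ *"defined on an interval [0, γ], γ > 0"*; 263 *"a positive, absolute γ"*); `M`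
(257 tl.5 *"closed cubes of a size M"*); `κ` (257–258, (0.25)–(0.26)); `Cfg n` = the configurations on which the step-n
functions are evaluated at their own scale (260–261: the background fields U_n = U_n(V), V regular on T₁^{(n)}; abstract),
`one n` = the configuration U_n(1) = 1; the three TERM SLOTS of (1.3)∕(1.6) at step j+1 as functions of the history and of
U_{j+1}: `logZ j` = log Z^{(j)}(·) (260 (1.3)–(1.4), zeroth order — NO coupling argument), `Eint j p` = 𝐄^{(j+1)}(g_j, ·) of
(1.3) (= (2.13), 268), `Ebold j p` = 𝐄^{(j+1)}(g_j, ·) of (1.6) (261); `repr437 j F E` = SLOT-PREDICATE: *F has the localized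
representation (1.7) (261) ∕ (4.37) (291), its terms analytic on U^c_{j+1}(X, α₀, α₁) ((1.11)–(1.16), (4.4)) and obeying the
(1.18)-type bound |F(X, 𝐔, 𝐉)| ≦ E exp(−κ d_{j+1}(X)) with THE CONSTANT E* (261–263; E a binder — BINDER row D4 need N-D4-3;
tree content `Step.SFTower.bound118`, `B12Decay510`); `α₀ α₁` (262–263, U^c_j(X, α₀, α₁)); `E₀` (263 (1.18)); `Mκ` = M(κ)
(263 *"for M ≧ M(κ)"*); `pol j F` = the polarization of F after the limit: the real kernel Π_{μν}(x − x′) on ℤ⁴ with δ^{ab}Π =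
lim_{T^{(j+1)}↗ℤ^d} (δ²∕δB^a_μ(x)δB^b_ν(x′)) F(U_{j+1}(exp iB))|_{B=0} (264 (1.20)–(1.21), 292 (5.1); abstract — finite-volume body
`B12PolarizationTensor120.polTensor`, colour reduction `…exists_scalar_kernel_polTensor_expChart`, limit `B12Limit51`);
`polIV j p` = Π_{j+1,μν}(g_j, ·) (264 (1.21)); `κ₀` (264, Theorem 3); `indAss P k` = SLOT: the action A_k of the run P
*"satisf[ies] all the inductive assumptions described between (1.1)–(1.22)"* (264, Theorem 3; content = the cell's `Step` ∕
`B12StepObligation` ∕ `B12Thm3Assembly`); `ε₁` (266 (2.9)); `altCutoff266` (266: SLOT∕FLAG *"to take g_k∕γ_kε₁ instead of ε₁"*,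
under which 𝐄^{(j)}, β_j are analytic in the couplings — it decides the «(or analytic)» of pp. 263–264); `logN2 k p` =
log N″_k (268 (2.14)); `δ₀` (282), `δ₁`, `C510` = the O(1) of (5.10) (293), `C544` = the O(1) of (5.44) (297).  d = 4 is fixed
in the index type `Fin 4` (p. 259; Theorem 2 «Let d = 4»).
[cite: Balaban1987RG1, §0 pp.251–256, §1 pp.260–264, (2.13)–(2.15) p.268, §5 pp.292–297] -/
structure Setting : Type 1 where
  /-- p. 251: *"L is an odd, positive integer > 11"* (the block size). -/
  L : ℕ
  /-- SLOT, pp. 251–252 ∕ 259 ∕ 260: the sentences on the gauge group G (semisimple compact, G ⊂ U(N); SU(2) in Thm 2). -/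
  groupScope : Prop
  /-- ε₀ of the regularity ∕ small-field conditions (p. 254 tl.22, (0.16) p. 255, (1.2) p. 260). -/
  ε₀ : ℝ
  /-- the effective couplings g_k of the run with parameters P = (K, m, g₀) ((0.17)–(0.20), pp. 255–256). -/
  cpl : B12.RunParams → ℕ → ℝ
  /-- the β-functions, history-dependent: `β j p = β_{j+1}(g₀, …, g_j)` ((0.18) p. 255; p. 256 tl.33; p. 298 tl.37–39). -/
  β : HBeta
  /-- Theorem 3's γ (first on p. 255: β₁ «defined on an interval [0, γ], γ > 0»; p. 263 «a positive, absolute γ»). -/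
  γ : ℝ
  /-- the cube size M (p. 257 tl.5) of Theorem 3's «M ≧ M(κ)». -/
  M : ℝ
  /-- the decay constant κ of (0.25)–(0.26) ∕ (1.18) (pp. 257–258, 263), Theorem 3's «κ ≧ κ₀». -/
  κ : ℝ
  /-- the configurations on which the step-n functions are evaluated at their own scale (pp. 260–261; abstract). -/
  Cfg : ℕ → Type
  /-- the configuration 1 at step n (the argument of «log Z^{(j)}(1)», «𝐄^{(j+1)}(g_j, 1)» in (1.3)∕(1.6)). -/
  one : (n : ℕ) → Cfg n
  /-- SLOT (1.3)–(1.4) p. 260: U_{j+1} ↦ log Z^{(j)}(U_{j+1}), the zeroth-order term (no coupling argument). -/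
  logZ : (j : ℕ) → Cfg (j + 1) → ℝ
  /-- SLOT (1.3) p. 260 ∕ (2.13) p. 268: (g₀, …, g_j; U_{j+1}) ↦ 𝐄^{(j+1)}(g_j, U_{j+1}), the interaction term of (1.3). -/
  Eint : (j : ℕ) → (Fin (j + 1) → ℝ) → Cfg (j + 1) → ℝ
  /-- SLOT (1.6) p. 261: (g₀, …, g_j; U_{j+1}) ↦ 𝐄^{(j+1)}(g_j, U_{j+1}), zeroth order and interaction merged. -/
  Ebold : (j : ℕ) → (Fin (j + 1) → ℝ) → Cfg (j + 1) → ℝ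
  /-- SLOT-PREDICATE (1.7) p. 261 ∕ (1.18) p. 263 ∕ (4.37) p. 291: `repr437 j F E` = F has the localized representation with
  analytic terms obeying the (1.18)-type bound with constant `E` (a binder). -/
  repr437 : (j : ℕ) → (Cfg (j + 1) → ℝ) → ℝ → Prop
  /-- α₀ of the spaces U^c_j(X, α₀, α₁) (pp. 262–263). -/
  α₀ : ℝ
  /-- α₁ of the spaces U^c_j(X, α₀, α₁) (pp. 262–263). -/
  α₁ : ℝ
  /-- the constant E₀ of (1.18) p. 263 (*"There exists a constant E₀ such that"*; no sign printed). -/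
  E₀ : ℝ
  /-- Theorem 3's threshold function M(κ) (p. 263 «for M ≧ M(κ)», p. 264). -/
  Mκ : ℝ → ℝ
  /-- SLOT-OPERATOR (1.20)–(1.21) p. 264 ∕ (5.1) p. 292: F ↦ its colour- and translation-reduced polarization kernel on ℤ⁴
  after the limit T^{(j+1)} ↗ ℤ^d. -/
  pol : (j : ℕ) → (Cfg (j + 1) → ℝ) → B12Beta.Kernel 4
  /-- (1.21) p. 264: the real kernels Π_{j+1,μν}(g_j, x) on ℤ⁴, one per step and history. -/
  polIV : (j : ℕ) → (Fin (j + 1) → ℝ) → B12Beta.Kernel 4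
  /-- Theorem 3's threshold κ₀ (p. 264). -/
  κ₀ : ℝ
  /-- SLOT, Theorem 3 p. 264: A_k of the run P satisfies *"all the inductive assumptions described between (1.1)–(1.22)"*. -/
  indAss : B12.RunParams → ℕ → Prop
  /-- ε₁ of the characteristic functions χ_k, (2.9) p. 266. -/
  ε₁ : ℝ
  /-- SLOT∕FLAG, p. 266 tl.32–37: the characteristic functions are taken *"with g_k∕γ_kε₁ instead of ε₁"*. -/
  altCutoff266 : Prop
  /-- (2.14) p. 268: log N″_k, the normalization constant of (2.12) (a function of the history). -/
  logN2 : (k : ℕ) → (Fin (k + 1) → ℝ) → ℝ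
  /-- δ₀ of p. 282 ∕ (4.5) (the decay constant entering «δ₁ determined by δ₀, κ, and M», p. 293). -/
  δ₀ : ℝ
  /-- the δ₁ of (5.10) p. 293 (*"e.g., δ₁ = 1∕2min{δ₀, κM⁻¹}"*; tree `B12Decay510.delta1`). -/
  δ₁ : ℝ
  /-- the O(1) of (5.10) p. 293. -/
  C510 : ℝ
  /-- the O(1) of (5.44) p. 297. -/
  C544 : ℝ

/-- The setting's run family read as the tree's `Setup.Flow`-valued map of `Missing.B12Thm2Shape` ∕
`FlowStep.B12Thm2Shape_of_betaBoundsH`: at lattice parameters `P` (only `P.K`, `P.m` are consulted — d = 4 and L are fixed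
inside the setting, as in `B12Thm2Bridge.flowOf`) and bare coupling g₀, the couplings are `S.cpl ⟨P.K, P.m, g₀⟩` and the
MARKOV β-component (the only shape `Setup.Flow` has) is the last-variable section of the history-dependent β along that run:
`β_{k}(x) := β (k−1) ((g₀, …, g_{k−2}, x))`, `β₀ := 0` (unused by (0.20)).  A dictionary, not a claim.
[cite: Balaban1987RG1, (0.20) p.256 with p.298 (history dependence)] -/
def flowOf (S : Setting) : Params → ℝ → Flow := fun P g₀ =>
  { g := S.cpl ⟨P.K, P.m, g₀⟩
    β := fun k x => match k with
      | 0 => 0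
      | k + 1 => S.β k (Function.update (prefixOf (S.cpl ⟨P.K, P.m, g₀⟩) k) (Fin.last k) x) }

/-- The last-variable section of β_{j+1} along the run `P`: s ↦ β_{j+1}(g₀, …, g_{j−1}, s) with g₀, …, g_{j−1} THE RUN'S
couplings (p. 264: β_{j+1}(g_j) *"defined on the interval [0, γ]"*; p. 298: *"We write β_j as explicitly dependent on g_{j−1},
although it depends also on all preceding coupling constants"*).  The shape of `B12CouplingClausesHistory`'s schemata at
the frozen history `prefixOf (S.cpl P) j`. [cite: Balaban1987RG1, p.264 (β-clause after (1.22)) with p.298] -/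
def lastSection (S : Setting) (P : B12.RunParams) (j : ℕ) : ℝ → ℝ :=
  fun s => S.β j (Function.update (prefixOf (S.cpl P) j) (Fin.last j) s)

/-- The run's history with the last coupling replaced by `s`: (g₀, …, g_{j−1}, s) — the argument at which the step-(j+1)
objects 𝐄^{(j+1)}(g_j, ·), Π_{j+1}(g_j, ·) are read when print lets *"g_{j−1} ∈ [0, γ]"* (p. 263) ∕ *"[0, γ]"* (p. 264) vary
with the preceding couplings those of the run (p. 298). [cite: Balaban1987RG1, p.263–264 with p.298] -/
def sectionHist (S : Setting) (P : B12.RunParams) (j : ℕ) (s : ℝ) : Fin (j + 1) → ℝ :=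
  Function.update (prefixOf (S.cpl P) j) (Fin.last j) s

/-- `lastSection` is β read at `sectionHist`. [cite: Balaban1987RG1, p.264 (β-clause after (1.22)) with p.298] -/
theorem lastSection_eq (S : Setting) (P : B12.RunParams) (j : ℕ) (s : ℝ) :
    lastSection S P j s = S.β j (sectionHist S P j s) := rfl

/-- The printed coupling domain of β_{j+1} as a function of its history: the preceding couplings g₀, …, g_{j−1} in
]0, γ] (Theorem 3 p. 264 *"0 < g_k ≦ γ"*) and the last one g_j in the closed interval (p. 264: *"defined on the interval
[0, γ]"*; p. 255: β₁(g₀) *"defined on an interval [0, γ]"*) — the set of `Function.update q (Fin.last j) s`, `q ∈ ]0, γ]^{j+1}`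
(`FlowStep.Box`), `s ∈ [0, γ]`, the convention of `B12CouplingClausesHistory`. [cite: Balaban1987RG1, p.264 (β-clause after (1.22)) with Thm 3 p.264] -/
def histDom (γ : ℝ) (j : ℕ) : Set (Fin (j + 1) → ℝ) :=
  {p | (∀ i, i ≠ Fin.last j → 0 < p i ∧ p i ≤ γ) ∧ 0 ≤ p (Fin.last j) ∧ p (Fin.last j) ≤ γ}

/-- One of the two lattice «derivatives» of (5.15)∕(5.38) acting on a position-space kernel: `(κ, true)` ↦ the backward
difference (symbol side: the conjugate `\overline{∂_κ(p)}`; `PeriodicGleason.delta`), `(κ, false)` ↦ the forward difference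
(symbol `∂_κ(p) = e^{ip_κ} − 1`; `B12Rep537.fdelta`, cf. `B12Rep537.genFun_fdelta`). [cite: Balaban1987RG1, (5.38) p.297 with (5.15) p.293] -/
def diffOp {d : ℕ} (a : Fin d × Bool) (g : Pt d → ℂ) : Pt d → ℂ :=
  cond a.2 (delta a.1 g) (B12Rep537.fdelta a.1 g)

/-- A third-order monomial in the derivatives ∂̄(p), ∂(p) of (5.38), position side: the word `w = (a₀, a₁, a₂)` acts as
`D_{a₀} ∘ D_{a₁} ∘ D_{a₂}`. [cite: Balaban1987RG1, (5.38) p.297] -/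
def diffWord {d : ℕ} (w : Fin 3 → Fin d × Bool) (g : Pt d → ℂ) : Pt d → ℂ :=
  diffOp (w 0) (diffOp (w 1) (diffOp (w 2) g))

/-- **Standing hypotheses** — p. 251's conditions on L and G, then THEOREM 3's hypotheses on the constants (p. 264,
verbatim: *"There exist positive constants κ₀, M(κ), γ, ε₀, ε₁, α₀, α₁ such, that if κ ≧ κ₀, M ≧ M(κ), 0 < g_k ≦ γ for
k = 0, 1, …, K, then …"*), one binder per printed condition, printed order: `hL` (*"L is an odd, positive integer > 11"*);
`hG` (the group slot); positivity of κ₀, M(κ), γ, ε₀, ε₁, α₀, α₁ in the printed list order; «κ ≧ κ₀»; «M ≧ M(κ)».  The run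
condition («defined inductively by … (0.17)–(0.20)», «0 < g_k ≦ γ, k = 0, …, K») is NOT a property of the setting: it is
`RunHyp S P`, the antecedent of each run-level field of `Conclusions`.  «ε₀, ε₁, α₀, α₁ depend on M … γ depends on all other
constants» = the quantifier shell of `B12.Thm3Printed` (not re-typed on fixed letters).  No sign of E₀, δ₀ or of the O(1)'s
is printed; none is assumed. [cite: Balaban1987RG1, Thm 3 p.264 with p.251] -/
structure StandingHypotheses (S : Setting) : Prop where
  hL : Odd S.L ∧ 11 < S.L
  hG : S.groupScope
  hκ₀ : 0 < S.κ₀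
  hMκ : 0 < S.Mκ S.κ
  hγ : 0 < S.γ
  hε₀ : 0 < S.ε₀
  hε₁ : 0 < S.ε₁
  hα₀ : 0 < S.α₀
  hα₁ : 0 < S.α₁
  hκ : S.κ₀ ≤ S.κ
  hM : S.Mκ S.κ ≤ S.M

/-- **Theorem 3's hypothesis ON THE RUN** with parameters P = (K, m, g₀), verbatim p. 264: *"… 0 < g_k ≦ γ for k = 0, 1, …,
K, then the sequence of actions A_k, defined inductively by the small field renormalization transformations (0.17)–(0.20)
…"* — `rg`: the couplings of the run obey (0.20) *"1∕g_k² = 1∕g²_{k+1} + β_{k+1}(g_k)"* for k < K (p. 256 tl.7–10: *"the sequence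
of actions and coupling constants is defined for k = 0, 1, …, K"*), β read at the run's history (p. 298) — the tree's
`FlowStep.RGEqH`; `inInterval`: H_γ, the tree's `Step.InInterval` (= Theorem 1's *"contained in an interval ]0, γ]"*,
p. 259).  Every d = 4 theorem of the series takes H_γ as hypothesis (p. 259: *"we do not assume any special asymptotic behavior
of the coupling constants, like asymptotic freedom"*); only the unproved Theorem 2 would discharge it. [cite: Balaban1987RG1, Thm 3 p.264 with (0.20) p.256 and Thm 1 p.259] -/
structure RunHyp (S : Setting) (P : B12.RunParams) : Prop where
  rg : FlowStep.RGEqH P.K S.β (S.cpl P)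
  inInterval : Step.InInterval S.γ P.K (S.cpl P)

/-- **The printed definitions** linking the objects, printed order.
* `d018` — (0.17)–(0.18) p. 255: the run with parameters (K, m, g₀) starts at the *"bare coupling constant g₀"*.
* `d020` — (0.20) p. 256: *"the coupling constant g_{k+1} is determined from the equation 1∕g_k² = 1∕g²_{k+1} + β_{k+1}(g_k).
  (0.20)"* (= (2.15) p. 268 *"with the β-function defined by the formulas (1.20), (1.22) for j = k"*), β read at the run's
  history (p. 298): whenever the couplings up to step k < K are positive and 1∕g_k² − β_{k+1}(g₀, …, g_k) > 0, g_{k+1} is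
  THE POSITIVE SOLUTION of (0.20) — the forward-determination form (`hfwd` of `FlowStep.B12Thm2Shape_of_betaBoundsH`); print
  defines the run by this recursion and does not assert its solvability for every (K, m, g₀) (runs that break off are not
  objects of the text; DELTA-I D-4); along the runs the theorems speak about, (0.20) itself is `RunHyp.rg`.
* `d13` — (1.3) = (1.6) pp. 260–261: *"In many considerations it is not necessary to separate the terms of zeroth order
  from the remaining terms in the interaction, and then we write (1.6)"* — the merged term's increment over U = 1 is the sum of
  the zeroth-order and the interaction increments (two named slots and their merge — BINDER row D4 need N-D4-1).
* `d213` — p. 268 tl.23, of (2.13) *"𝐄^{(k+1)}(g_k, U_{k+1}) = log ∫ dμ_{C^{(k)}}(B) χ_k exp[𝐏^{(k)}(g_k, U_{k+1}, B) + {…}]"*: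
  *"Let us remark that the expression under the exponential above vanishes at g_k = 0"* — at g_k = 0 the interaction slot no
  longer depends on ANY coupling (the exponent is 0; what is left, log ∫dμ_{C^{(k)}}χ_k, carries no coupling) (N-D4-2; with the
  cut-off (2.9) proper, χ_k is moreover vacuous at g_k = 0 after the rescaling B = g_kB′ of p. 267 — a reading, DELTA-I D-6);
  `d214` — *"and log N″_k = 𝐄^{(k+1)}(g_k, 1). (2.14)"*.
* `d120` — (1.20)–(1.21) p. 264: *"the β-functions β_{j+1}(g_j). They are determined by the functions 𝐄^{(j+1)}(g_j, U_{j+1}) in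
  (1.6). Let us denote 𝐄^{(j+1)}(g_j, B) = 𝐄^{(j+1)}(g_j, U_{j+1}(exp iB)). We define Π^{ab}_{j+1,μν}(g_j, x, x′) =
  (δ²∕(δB^a_μ(x)δB^b_ν(x′)) 𝐄^{(j+1)})(g_j, 0). (1.20) … This implies Π^{ab}_{j+1,μν}(g_j, x, x′) = δ^{ab}Π_{j+1,μν}(g_j, x − x′),
  Π_{j+1}(g_j, rb, rb′) = Π_{j+1}(g_j, b, b′), (1.21) where Π_{j+1,μν}(g_j, x) is a real valued function, and r is a Euclidean
  rotation leaving the lattice T^{(j+1)} invariant. Now we take a limit of these functions as T^{(j+1)} ↗ Z^d. This limit exists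
  by the localized representation (1.7)."* — typed on the kernel after the limit (DELTA-I D-7): `polIV j p = pol j (Ebold j p)`;
  `d120split` — the BOOKKEEPING consequence of (1.3)∕(1.6) (the second variational derivative is additive and kills the
  constants 𝐄(g_j, 1), log Z(1)): pol 𝐄^{(j+1)} = pol log Z^{(j)} + pol 𝐄^{(j+1)}_int — not a displayed sentence (cf.
  `B12Beta.OneLoopSplit`, DELTA-I D-8); `d121` — (1.21)₂ in the ℤ⁴-component form print gives it in §5: axis permutations
  (5.6) (`B12Beta.PermCovariant`), reflections (5.7) *"Π_{μν}(εx − (1−ε_μ)∕2 e_μ, εy − (1−ε_ν)∕2 e_ν) = ε_με_νΠ_{μν}(x, y)"*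
  written for the difference variable, and (5.8) *"Π_{μν}(x, y) = Π_{μν}(x − y), Π_{μν}(x) = Π_{νμ}(−x)"* (translation
  invariance is built into the kernel type).  NOTE (DELTA-I D-18): this reflection clause is satisfied, for every sign
  vector, by the transposed marginal `B12Rep537.wilsonQ ν μ` and NOT, for μ ≠ ν, by the literal (5.37) kernel
  `B12Rep537.wilsonQ μ ν` that `Conclusions.c537` subtracts (witness: ε = −1 in direction ν only, z = 0) — a β-blind
  transposition located INSIDE [I] §5 ((5.16)∕(5.37) against (5.7)∕(5.9)∕(5.11)∕(5.15)), carried [sic]; `d121` itself is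
  print's (5.6)–(5.8) unrepaired.
* `d122` — (1.22) p. 264, verbatim: *"The function β_{j+1}(g_j) is defined by β_{j+1}(g_j) = −(∂²∕∂p₁∂p₂ Π̃_{j+1,12})(g_j, 0) =
  −(∂²∕∂p_μ∂p_ν Π̃_{j+1,μν})(g_j, 0) = Σ_x Π_{j+1,μν}(g_j, x)x_μx_ν (1.22) for μ, ν arbitrary, μ ≠ ν, where f̃(p) denotes the
  Fourier transform of the function f(x), x ∈ Z^d."* = (5.42) p. 297 *"This is the fundamental equality defining the
  β-function"*: BOTH printed equalities, for every pair μ ≠ ν, on the printed coupling domain `histDom` (preceding couplings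
  in ]0, γ], g_j ∈ [0, γ] — p. 264 «defined on the interval [0, γ]»; Π̃ = `BJ86EffectiveAction.fourierT`, ∂²∕∂p_μ∂p_ν at 0 =
  `mixedDeriv0`, Σ_x … = `B12Beta.secondMoment`; the tree links the two members for summable kernels:
  `neg_mixedDeriv0_fourierT_eq_secondMoment`).
[cite: Balaban1987RG1, (0.18)–(0.20) pp.255–256, (1.3)–(1.6) pp.260–261, (1.20)–(1.22) p.264, (2.13)–(2.15) p.268, (5.6)–(5.8) p.293] -/
structure Definitions (S : Setting) : Prop where
  d018 : ∀ P : B12.RunParams, S.cpl P 0 = P.g0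
  d020 : ∀ (P : B12.RunParams) (k : ℕ), k < P.K → (∀ i, i ≤ k → 0 < S.cpl P i) →
    0 < 1 / (S.cpl P k) ^ 2 - S.β k (prefixOf (S.cpl P) k) →
      0 < S.cpl P (k + 1) ∧ 1 / (S.cpl P k) ^ 2 = 1 / (S.cpl P (k + 1)) ^ 2 + S.β k (prefixOf (S.cpl P) k)
  d13 : ∀ (j : ℕ) (p : Fin (j + 1) → ℝ) (U : S.Cfg (j + 1)),
    S.Ebold j p U - S.Ebold j p (S.one (j + 1)) =
      (S.logZ j U - S.logZ j (S.one (j + 1))) + (S.Eint j p U - S.Eint j p (S.one (j + 1)))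
  d213 : ∀ (k : ℕ) (p p' : Fin (k + 1) → ℝ), p (Fin.last k) = 0 → p' (Fin.last k) = 0 → S.Eint k p = S.Eint k p'
  d214 : ∀ (k : ℕ) (p : Fin (k + 1) → ℝ), S.logN2 k p = S.Eint k p (S.one (k + 1))
  d120 : ∀ (j : ℕ) (p : Fin (j + 1) → ℝ), S.polIV j p = S.pol j (S.Ebold j p)
  d120split : ∀ (j : ℕ) (p : Fin (j + 1) → ℝ), S.pol j (S.Ebold j p) = S.pol j (S.logZ j) + S.pol j (S.Eint j p)
  d121 : ∀ (j : ℕ) (p : Fin (j + 1) → ℝ), B12Beta.PermCovariant (S.polIV j p) ∧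
    (∀ ε : Fin 4 → ℤ, (∀ μ, ε μ = 1 ∨ ε μ = -1) → ∀ (μ ν : Fin 4) (z : Fin 4 → ℤ),
      S.polIV j p μ ν (fun κ => ε κ * z κ - (if κ = μ then (1 - ε μ) / 2 else 0) + (if κ = ν then (1 - ε ν) / 2 else 0))
        = ε μ * ε ν * S.polIV j p μ ν z) ∧
    (∀ (μ ν : Fin 4) (z : Fin 4 → ℤ), S.polIV j p μ ν z = S.polIV j p ν μ (-z))
  d122 : ∀ (j : ℕ) (p : Fin (j + 1) → ℝ), p ∈ histDom S.γ j → ∀ μ ν : Fin 4, μ ≠ ν →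
    (S.β j p : ℂ) = -mixedDeriv0 (fourierT (S.polIV j p μ ν)) μ ν ∧ S.β j p = B12Beta.secondMoment (S.polIV j p) μ ν

/-- **The printed conclusions**, one field per claim, printed order; every run-level field has Theorem 3's run hypothesis
`RunHyp S P` («defined inductively by (0.17)–(0.20)», «0 < g_k ≦ γ for k = 0, 1, …, K») as antecedent, for every run parameter
P = (K, m, g₀); the step-(j+1) items are read for the run's history (g₀, …, g_{j−1}) and EVERY last coupling s ∈ [0, γ]
(`sectionHist`; p. 263 *"of g_{j−1} ∈ [0, γ]"*, p. 264 *"on the interval [0, γ]"*).  STATEMENT vs PROOF, as printed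
(DELTA-I D-19): Theorem 3 delivers the items at the steps j + 1 ≤ K of a run ALREADY known to satisfy H_γ up to K, so
β_{K+1}(g₀, …, g_K) — the function (0.20) needs to define g_{K+1} — is reached only by Theorem 3 at K + 1, i.e. once
g_{K+1} ∈ ]0, γ] is known; that the run extended by (0.20) stays in ]0, γ] is Theorem 2's content ∕ the PROOF architecture
of pp. 255–256 (β_{k+1} is produced from A_k before g_{k+1} is chosen), which no printed STATEMENT carries — consumers add
it as an explicit letter (the letters `hrg` ∕ halting ∕ box (U) of the row-D4 junction's consumers —
`EriceFlowEnclosureB12AsPrintedTuned` ∕ `…TunedUpper` ∕ `…LowerEnd` —, certified NOT derivable from this interface even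
together with Theorem 2: `B12AsPrintedRowD4JunctionHrgWitness`, Summits side).  LIKEWISE (DELTA-I D-20) the CONTINUITY of
β_{k+1} in ALL its couplings g₀, …, g_k, which every reduction of Theorem 2's first sentence in the cell uses (g_K is reached
from g₀ through β₁(g₀), β₂(g₀, g₁), …, β_K(g₀, …, g_{K−1}) by (0.20); «there exists g₀ = g₀(ε, g) … g_K = g» is read off the map
g₀ ↦ g_K): Theorem 2 is stated without proof, and no printed statement carries a regularity of β_{j+1} in the preceding
couplings g₀, …, g_{j−1} — `c264` below is the LAST variable, as p. 264 prints it; p. 298 tl.37–39 states the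
dependence only; p. 266's sentence on the alternative cut-off is typed by name outside this structure (module docstring «NOT
typed here») —; consumers add the letter `FlowStep.BetaContH` («(C)»), certified NOT derivable from this interface with the
flag `altCutoff266` ON: `EriceFlowEnclosureB12AsPrintedHistoryJumpEnd.histCont_loadBearing`, Summits side.
* `c13` — THEOREM 3 p. 264, verbatim: *"There exist positive constants κ₀, M(κ), γ, ε₀, ε₁, α₀, α₁ such, that if κ ≧ κ₀,
  M ≧ M(κ), 0 < g_k ≦ γ for k = 0, 1, …, K, then the sequence of actions A_k, defined inductively by the small field
  renormalization transformations (0.17)–(0.20), satisfy all the inductive assumptions described between (1.1)–(1.22). The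
  constants ε₀, ε₁, α₀, α₁ depend on M and satisfy numerous restrictions, which will become clear in the proof. The constant γ
  depends on all other constants."* — the conclusion as the slot `indAss P k` for k ≤ K (PROVED by the author's account in
  [I] §§2–5 + [Balaban1988RG2Cluster], p. 22 there; tree `B12Thm3Assembly`); the items of that inductive list which concern β
  follow explicitly, at every step j + 1 ≤ K of the run:
* `c118` — (1.7) p. 261 with (1.18) p. 263, for BOTH 𝐄-slots with the one printed constant E₀ (p. 261: *"We can assume that
  this representation holds for the functions 𝐄^{(j)} in (1.3) and (1.6)"*; p. 263: *"It is a C^∞-function of g_{j−1} ∈ [0,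
  γ] … There exists a constant E₀ such that |𝐄^{(j)}(X, g_{j−1}, 𝐔, 𝐉)| ≦ E₀ exp(−κd_j(X)) (1.18)"*; DELTA-I D-9).
* `c264` — p. 264 tl.25–27, of β_{j+1}(g_j), verbatim: *"It is a smooth function defined on the interval [0, γ], (or analytic),
  uniformly bounded on this interval together with all derivatives. We will investigate other properties in a separate
  paper."*, placed where print places it: *"This completes the description of the inductive assumptions."* (tl.28), i.e.
  INSIDE Theorem 3's conclusion — for the run's own history and the last variable on [0, γ] (`lastSection`): smooth; analytic
  under the p. 266 alternative («(or analytic)»: *"We have formulated the implications of both possibilities in the inductive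
  description"*) — in the LAST variable on [0, γ], which is how the inductive description (this clause; p. 263's for 𝐄^{(j)})
  formulates that implication; p. 266's own sentence reads *"analytic functions of the effective coupling constants"* and its
  JOINT reading (in g₀, …, g_j together) is the tree's `B12CouplingClausesHistory.BetaAnalyticInCouplings266`, by name, NOT this
  member (DELTA-I D-15 ∕ D-20; the joint schema implies this member, `analytic264_of_box`, and the consumers' continuity letter
  `FlowStep.BetaContH`, which this member does not: `EriceFlowEnclosureB12AsPrintedHistoryJumpEnd`, Summits side) —; and, per
  j and per order n, ONE bound on the n-th derivative over [0, γ] — «uniformly» = in the interval;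
  NO lettered constant, NO j- or history-uniformity is printed (N-D4-4; the weakest reading, under which the bound adds nothing
  to smoothness on the compact interval — `B12CouplingClausesHistory.betaDerivsBoundedInLast264_of_smooth`; the uniform
  readings are `…BetaDerivsUniformInLast264` ∕ `BetaDerivClause.LastVarDerivBound`; DELTA-I D-10).
* `c510` — (5.10) p. 293, verbatim: *"The representation (4.37) yields the following inequality |Π_{μν}(x − y)| ≦ O(1)E₀
  exp(−δ₁|x − y|), (5.10) with a positive constant δ₁ determined by δ₀, κ, and M (e.g., δ₁ = 1∕2min{δ₀, κM⁻¹})."* — as the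
  SCHEMA the sentence states («(4.37) yields»): for every step, every function F with the representation-and-bound `repr437 j
  F E` and every constant E, the kernel `pol j F` decays at rate δ₁ > 0 with constant O(1)·E (N-D4-3: instantiate with E₀ for
  𝐄 — `c118` — or with another slot's constant; print DISPLAYS the instance F = 𝐄^{(j)}, E = E₀; derivation SKETCH in [I],
  bounds completed in [II] — fidelity ledger §2.2; tree `B12Decay510`, `B12Sec2to5.Decay510`; |x − y| = the ℓ¹ size
  `B12Sec2to5.l1`, DELTA-I D-11).
* `c537` — (5.37)–(5.38) p. 297 with (5.44) and p. 298 tl.5, verbatim: *"Π_{μν}(p) = β(δ_{μν}Δ(p) − \overline{∂_μ(p)}∂_ν(p)) +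
  Π′_{μν}(p). (5.37) The function Π′_{μν}(p) has all the symmetries of the function Π_{μν}(p) and it can be written in the form
  of a third order polynomial in the derivatives \overline{∂(p)}, ∂(p), Π′_{μν}(p) = Σ_{κ,λ,ρ}[Π′_{μν,κλρ}(p)\overline{∂_κ(p)}
  \overline{∂_λ(p)}\,\overline{∂_ρ(p)} + Π′_{μν,κ,λρ}(p)∂_κ(p)\overline{∂_λ(p)}\,\overline{∂_ρ(p)} + …]. (5.38) The coefficients
  Π′ can be extended to analytic functions of ζ = p + iq on the polystrip ×_μ{|q_μ| < δ₁}."*; *"|Π′_{μν,κλρ}(x − y)| ≦ O(1)E₀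
  exp(½δ₁|x − y|) [sic: −½δ₁]. (5.44)"*; *"Defining the function β_j as equal to the coefficient β in (5.43)"* — for the
  polarization of the run's 𝐄^{(j+1)} at every last coupling in [0, γ] and every (μ, ν): there are coefficient kernels Π′_w,
  one per third-order word w in the 2d derivatives, with Π_{μν} − β_{j+1}(g₀, …, g_j)·Q_{μν} = Σ_w D_w Π′_w pointwise on ℤ⁴
  and each Π′_w bounded by O(1)E₀e^{−½δ₁|x|₁} — position side on the complex carrier of `B12Rep537` (`wilsonQ μ ν` = the
  kernel whose symbol is δ_{μν}Δ(p) − \overline{∂_μ(p)}∂_ν(p), `genFun_wilsonQ`; the polystrip analyticity is carried by its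
  printed consequence (5.44), *"The analyticity properties mentioned after (5.38) imply the corresponding exponential decay
  properties"*; PROOF pp. 294–297 given (5.10) — `B12Rep537.rep538_of_decay510` derives this shape from (5.10) + the
  second-order Taylor data; DELTA-I D-12).  ORIENTATION, carried [sic] (DELTA-I D-18; the finding is the row's, bflow-p1 ∕
  an4, 2026-08-27, re-read on the page by this desk): the field subtracts (5.37)'s marginal LITERALLY — `wilsonQ μ ν`, whose
  symbol under (5.11) is δ_{μν}Δ(p) − \overline{∂_μ(p)}∂_ν(p) —; for μ ≠ ν that kernel violates `Definitions.d121`'s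
  reflection clause (5.7), and the family (μ, ν) ↦ `wilsonQ μ ν` violates the transversality (5.9) (Σ_μ ∂*_μ Q_{μν} ≢ 0); the
  transposed family (μ, ν) ↦ `wilsonQ ν μ` (symbol δ_{μν}Δ(p) − ∂_μ(p)\overline{∂_ν(p)}, the form (5.13)∕(5.15) select)
  satisfies both; hence, whenever β_{j+1} ≠ 0, the remainder Σ_w D_w Π′_w this field produces does NOT have «all the
  symmetries of the function Π_{μν}(p)» — that quoted sentence is NOT typed and is NOT a consequence of the typed fields (it
  holds for the split with `wilsonQ ν μ`); the coefficient β, (5.42) = `d122` and every bound on β are blind to the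
  transposition (moments of order ≤ 2 of Q and Qᵀ coincide).
NOT asserted; `c13`∕`c118`∕`c264` are Theorem 3 (proved by the author's account in [I]+[II]), `c510`∕`c537` are §5 (PROOF given
(5.10); (5.10) SKETCH in [I], completed in [II]) — fidelity ledger `CMP109-FIDELITY.md` §2.
[cite: Balaban1987RG1, Thm 3 p.264, (1.18) p.263, (5.10) p.293, (5.37)–(5.38) and (5.44) p.297, p.298] -/
structure Conclusions (S : Setting) : Prop where
  c13 : ∀ P : B12.RunParams, RunHyp S P → ∀ k, k ≤ P.K → S.indAss P k
  c118 : ∀ P : B12.RunParams, RunHyp S P → ∀ j, j + 1 ≤ P.K → ∀ s ∈ Set.Icc (0 : ℝ) S.γ,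
    S.repr437 j (S.Ebold j (sectionHist S P j s)) S.E₀ ∧ S.repr437 j (S.Eint j (sectionHist S P j s)) S.E₀
  c264 : ∀ P : B12.RunParams, RunHyp S P → ∀ j, j + 1 ≤ P.K →
    (∀ n : ℕ, ContDiffOn ℝ n (lastSection S P j) (Set.Icc 0 S.γ)) ∧
    (S.altCutoff266 → AnalyticOn ℝ (lastSection S P j) (Set.Icc 0 S.γ)) ∧
    (∀ n : ℕ, ∃ B : ℝ, ∀ s ∈ Set.Icc (0 : ℝ) S.γ,
      ‖iteratedDerivWithin n (lastSection S P j) (Set.Icc 0 S.γ) s‖ ≤ B)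
  c510 : 0 < S.δ₁ ∧ ∀ (j : ℕ) (F : S.Cfg (j + 1) → ℝ) (E : ℝ), S.repr437 j F E →
    ∀ μ ν : Fin 4, B12Sec2to5.Decay510 (S.pol j F μ ν) (S.C510 * E) S.δ₁
  c537 : ∀ P : B12.RunParams, RunHyp S P → ∀ j, j + 1 ≤ P.K → ∀ s ∈ Set.Icc (0 : ℝ) S.γ, ∀ μ ν : Fin 4,
    ∃ rem : (Fin 3 → Fin 4 × Bool) → Pt 4 → ℂ,
      (∀ x : Pt 4, (S.polIV j (sectionHist S P j s) μ ν x : ℂ) -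
          (S.β j (sectionHist S P j s) : ℂ) * B12Rep537.wilsonQ μ ν x = ∑ w, diffWord w (rem w) x) ∧
      ∀ w, ExpBound (S.δ₁ / 2) (S.C544 * S.E₀) (rem w)

end B12BetaAsPrinted

/-- **The β-functions and the coupling-constant renormalization of [Balaban1987RG1], EXACTLY AS PRINTED**, as one
predicate on a `B12BetaAsPrinted.Setting` (the printed objects): p. 251's conditions and Theorem 3's hypotheses on the
constants (`StandingHypotheses`, every printed condition a named binder) and the printed definitions (0.18)∕(0.20)∕(2.15),
(1.3)∕(1.6), (2.13)–(2.14), (1.20)–(1.22) = (5.42) (`Definitions`) IMPLY the printed claims (`Conclusions`: Theorem 3's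
conclusion for every run defined by (0.20) with 0 < g_k ≦ γ, k ≤ K — incl. (1.7)∕(1.18) and the β-clause of p. 264 at every step
— and §5's (5.10), (5.37)–(5.38) with (5.44)).  This is the part of the β-flow binder that IS IN PRINT (fidelity ledger §4.1:
DEFINED ∕ PROVED in [I]+[II], everything CONDITIONAL on the run hypothesis H_γ); the part that is NOT — Theorem 2, the only
printed statement that would discharge H_γ in d = 4 — is `B12BetaAsPrinted.Theorem2Statement`, kept apart.  A predicate, NOT
asserted for any setting and never a `theorem`.  Reading choices and abstract slots: `beta/asprinted/DELTA-I.md`.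
[cite: Balaban1987RG1, Thm 3 p.264 with (0.18)–(0.20) pp.255–256, (1.20)–(1.22) p.264, (5.10) p.293, (5.37)–(5.44) p.297] -/
def B12BetaAsPrinted (S : B12BetaAsPrinted.Setting) : Prop :=
  B12BetaAsPrinted.StandingHypotheses S → B12BetaAsPrinted.Definitions S → B12BetaAsPrinted.Conclusions S

namespace B12BetaAsPrinted

/-- `B12BetaAsPrinted` unfolded: hypotheses → definitions → conclusions. [cite: Balaban1987RG1, Thm 3 p.264] -/
theorem b12BetaAsPrinted_iff (S : Setting) :
    B12BetaAsPrinted S ↔ (StandingHypotheses S → Definitions S → Conclusions S) :=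
  Iff.rfl

/-- **THEOREM 2 of [Balaban1987RG1] (p. 259), BY NAME**, verbatim: *"Theorem 2. Let d = 4, G = SU(2), and let γ be a
sufficiently small positive constant, then for a sufficiently small positive g there exists a bare coupling constant g₀ =
g₀(ε, g) such that the sequence of the effective coupling constants g_k is contained in the interval ]0, γ], and g_K = g.
Moreover, there exist constants β, β′, 0 < β ≦ β′, such that g_k satisfy the inequality 1∕g² + β log(L^kε)^{−1} ≦ 1∕g_k² ≦
1∕g² + β′ log(L^kε)^{−1}. (0.31) A proof of this theorem, based on perturbative calculations, will be given in a separate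
paper, where more precise asymptotic behavior will be proved."* (p. 251 tl.18–19: *"will be discussed in another paper"*;
p. 264 tl.26–27: *"We will investigate other properties in a separate paper"*; [Balaban1989LargeFieldII] p. 355 (1989):
*"has not been published yet, so we have Theorem 1 with the assumption"*) — STATED WITHOUT PROOF; the tree's single typing
(`Missing.B12Thm2Shape` ≃ `B12.Thm2Printed`, `B12Thm2Bridge.thm2Printed_iff_missing`) instantiated at this setting's run
family `flowOf S` (d = 4, block size `S.L`, `hL` from `StandingHypotheses.hL` via `hL_of_standing`).  A NAMED HYPOTHESIS
SHAPE — never a fact, never a conjunct of `Conclusions` (CMP109-FIDELITY §4.2: its proof is the NOT-IN-PRINT half of the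
binder). [cite: Balaban1987RG1, Thm 2 (0.31) p.259] -/
def Theorem2Statement (S : Setting) (hL : Odd S.L ∧ 1 < S.L) : Prop :=
  Missing.B12Thm2Shape S.L hL (flowOf S)

/-- `Theorem2Statement` unfolded. [cite: Balaban1987RG1, Thm 2 (0.31) p.259] -/
theorem theorem2Statement_iff (S : Setting) (hL : Odd S.L ∧ 1 < S.L) :
    Theorem2Statement S hL ↔ Missing.B12Thm2Shape S.L hL (flowOf S) :=
  Iff.rfl

/-- `StandingHypotheses.hL` supplies the side condition of `Theorem2Statement` (11 < L gives 1 < L). [cite: Balaban1987RG1, p.251 («odd, positive integer > 11»)] -/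
theorem hL_of_standing {S : Setting} (h : StandingHypotheses S) : Odd S.L ∧ 1 < S.L :=
  ⟨h.hL.1, lt_trans (by norm_num) h.hL.2⟩

/-- The run's history prefix lies in the box ]0, γ]^{j+1} under Theorem 3's run hypothesis (bookkeeping for the dictionary
below). [cite: Balaban1987RG1, Thm 3 p.264 («0 < g_k ≦ γ for k = 0, 1, …, K»)] -/
theorem prefixOf_mem_box {S : Setting} {P : B12.RunParams} (hI : Step.InInterval S.γ P.K (S.cpl P)) {j : ℕ}
    (hj : j + 1 ≤ P.K) : prefixOf (S.cpl P) j ∈ Box S.γ j := by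
  rw [FlowStep.mem_box]
  intro i
  have hi : (i : ℕ) ≤ P.K := le_trans (Nat.le_of_lt_succ i.isLt) (le_trans (Nat.le_succ j) hj)
  simpa [prefixOf] using hI i hi

/-- The last-variable section of a box history at s ∈ [0, γ] lies in the printed coupling domain. [cite: Balaban1987RG1, p.264 (β-clause after (1.22)) with Thm 3 p.264] -/
theorem update_mem_histDom {γ : ℝ} {j : ℕ} {q : Fin (j + 1) → ℝ} (hq : q ∈ Box γ j) {s : ℝ} (hs : s ∈ Set.Icc (0 : ℝ) γ) :
    Function.update q (Fin.last j) s ∈ histDom γ j := by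
  refine ⟨fun i hi => ?_, ?_, ?_⟩
  · rw [Function.update_of_ne hi]
    exact (FlowStep.mem_box.1 hq) i
  · rw [Function.update_self]; exact hs.1
  · rw [Function.update_self]; exact hs.2

/-- Under Theorem 3's run hypothesis every `sectionHist S P j s`, s ∈ [0, γ], lies in the printed coupling domain (so
`Definitions.d122` applies along `lastSection`). [cite: Balaban1987RG1, p.264 (β-clause after (1.22)) with Thm 3 p.264] -/
theorem sectionHist_mem_histDom {S : Setting} {P : B12.RunParams} (hI : Step.InInterval S.γ P.K (S.cpl P)) {j : ℕ}
    (hj : j + 1 ≤ P.K) {s : ℝ} (hs : s ∈ Set.Icc (0 : ℝ) S.γ) : sectionHist S P j s ∈ histDom S.γ j :=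
  update_mem_histDom (prefixOf_mem_box hI hj) hs

/-- The run's own last coupling is one of the admissible values: `sectionHist S P j (g_j) = (g₀, …, g_j)` and g_j ∈ [0, γ]
under H_γ. [cite: Balaban1987RG1, Thm 3 p.264 («0 < g_k ≦ γ»)] -/
theorem sectionHist_self {S : Setting} (P : B12.RunParams) (j : ℕ) :
    sectionHist S P j (S.cpl P j) = prefixOf (S.cpl P) j := by
  unfold sectionHist
  conv_rhs => rw [← Function.update_eq_self (Fin.last j) (prefixOf (S.cpl P) j)]
  rfl

/-- DICTIONARY (N-D4-4): the history-uniform-in-the-box schema `BetaSmoothInLast264 γ β` of `B12CouplingClausesHistory`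
(smoothness of every last-variable section at EVERY frozen history in ]0, γ]^{k+1}) implies the as-printed per-run smoothness
clause of `Conclusions.c264` (at the run's own history). [cite: Balaban1987RG1, p.264 (β-clause after (1.22)) with p.298] -/
theorem smooth264_of_box {S : Setting} (h : B12CouplingClausesHistory.BetaSmoothInLast264 S.γ S.β)
    {P : B12.RunParams} (hI : Step.InInterval S.γ P.K (S.cpl P)) {j : ℕ} (hj : j + 1 ≤ P.K) (n : ℕ) :
    ContDiffOn ℝ n (lastSection S P j) (Set.Icc 0 S.γ) :=
  h j (prefixOf (S.cpl P) j) (prefixOf_mem_box hI hj) n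

/-- DICTIONARY: the «(or analytic)» schema `BetaAnalyticInLast264 γ β` of `B12CouplingClausesHistory` implies the as-printed
per-run analyticity clause of `Conclusions.c264` (whatever the cut-off flag). [cite: Balaban1987RG1, p.264 (β-clause after (1.22)) with p.266] -/
theorem analytic264_of_box {S : Setting} (h : B12CouplingClausesHistory.BetaAnalyticInLast264 S.γ S.β)
    {P : B12.RunParams} (hI : Step.InInterval S.γ P.K (S.cpl P)) {j : ℕ} (hj : j + 1 ≤ P.K) :
    AnalyticOn ℝ (lastSection S P j) (Set.Icc 0 S.γ) :=
  h j (prefixOf (S.cpl P) j) (prefixOf_mem_box hI hj)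

/-- DICTIONARY (N-D4-4): the weakest-reading schema `BetaDerivsBoundedInLast264 γ β` of `B12CouplingClausesHistory` implies
the as-printed per-run derivative-bound clause of `Conclusions.c264`. [cite: Balaban1987RG1, p.264 (β-clause after (1.22)) with p.298] -/
theorem derivBound264_of_box {S : Setting} (h : B12CouplingClausesHistory.BetaDerivsBoundedInLast264 S.γ S.β)
    {P : B12.RunParams} (hI : Step.InInterval S.γ P.K (S.cpl P)) {j : ℕ} (hj : j + 1 ≤ P.K) (n : ℕ) :
    ∃ B : ℝ, ∀ s ∈ Set.Icc (0 : ℝ) S.γ, ‖iteratedDerivWithin n (lastSection S P j) (Set.Icc 0 S.γ) s‖ ≤ B :=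
  h j (prefixOf (S.cpl P) j) (prefixOf_mem_box hI hj) n

/-- DICTIONARY (the one undisplayed line of CMP109-FIDELITY §2.2, reader 2 B2): the second printed equality of (1.22)∕(5.42)
and a (5.10)-type decay of the (μ, ν)-component with constant C and rate δ₁ > 0 give |β_{j+1}(g₀, …, g_j)| ≦
C·Σ_{x∈ℤ⁴}|x|₁²e^{−δ₁|x|₁}; the kernel step is the tree's `B12Sec2to5.secondMoment_abs_le_of_decay510`. [cite: Balaban1987RG1, (5.10) p.293 with (5.42) p.297 and p.264 («uniformly bounded»)] -/
theorem beta_abs_le_of_decay510 {S : Setting} {j : ℕ} {p : Fin (j + 1) → ℝ} {μ ν : Fin 4} {C δ₁ : ℝ}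
    (hβ : S.β j p = B12Beta.secondMoment (S.polIV j p) μ ν) (hδ : 0 < δ₁)
    (h510 : B12Sec2to5.Decay510 (S.polIV j p μ ν) C δ₁) :
    |S.β j p| ≤ C * ∑' x : Fin 4 → ℤ, B12Sec2to5.l1 x ^ 2 * Real.exp (-δ₁ * B12Sec2to5.l1 x) := by
  rw [hβ]
  exact (B12Sec2to5.secondMoment_abs_le_of_decay510 hδ h510).2

/-- **The undisplayed line, ON THE INTERFACE** (CMP109-FIDELITY §0 (i) ∕ §2.2: *«whence |β_{j+1}(g_j)| ≦ O(1)E₀C(δ₁) uniformly in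
j by (5.42) + (5.10) (one undisplayed line)»*): from `Definitions` ((1.20)∕(1.22)) and `Conclusions` ((1.7)+(1.18) for 𝐄^{(j+1)}
with E₀, and the (5.10) schema) — for every run defined by (0.20) with 0 < g_k ≦ γ (k ≤ K), every step j + 1 ≤ K, every last
coupling s ∈ [0, γ] and every pair μ ≠ ν: |β_{j+1}(g₀, …, g_{j−1}, s)| ≦ O(1)E₀ · Σ_{x∈ℤ⁴}|x|₁²e^{−δ₁|x|₁} — ONE constant for all
s, j and runs: p. 264's *"uniformly bounded on this interval"* with the constant print does not name; by value the constant is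
the tree's `B12Sec2to5.betaPrime510 4 (S.C510 * S.E₀) S.δ₁` (the β′ of `B12Sec2to5.betaUpper_of_decay510`; named form:
`abs_lastSection_le_betaPrime510` below).  Kernel-checked composition of the fields by name; nothing of [I] asserted. [cite: Balaban1987RG1, (5.10) p.293 with (5.42) p.297 and p.264 («uniformly bounded»)] -/
theorem beta_abs_le_of_conclusions {S : Setting} (hD : Definitions S) (hC : Conclusions S) {P : B12.RunParams}
    (hP : RunHyp S P) {j : ℕ} (hj : j + 1 ≤ P.K) {s : ℝ} (hs : s ∈ Set.Icc (0 : ℝ) S.γ) {μ ν : Fin 4} (hμν : μ ≠ ν) :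
    |lastSection S P j s| ≤
      S.C510 * S.E₀ * ∑' x : Fin 4 → ℤ, B12Sec2to5.l1 x ^ 2 * Real.exp (-S.δ₁ * B12Sec2to5.l1 x) := by
  have hβ := (hD.d122 j _ (sectionHist_mem_histDom hP.inInterval hj hs) μ ν hμν).2
  have h510 := hC.c510.2 j (S.Ebold j (sectionHist S P j s)) S.E₀ (hC.c118 P hP j hj s hs).1 μ ν
  rw [← hD.d120] at h510
  rw [lastSection_eq]
  exact beta_abs_le_of_decay510 hβ hC.c510.1 h510

/-- DICTIONARY (N-D4-2 at kernel level): by `Definitions.d213` the polarization of the interaction slot at g_k = 0 does not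
depend on the history either — the printed source of `B12Beta.OneLoopSplit.vanish` (there β¹ := the part vanishing at
g_k = 0). [cite: Balaban1987RG1, (2.13)–(2.14) p.268 («vanishes at g_k = 0»)] -/
theorem pol_Eint_eq_of_lastZero {S : Setting} (hD : Definitions S) {k : ℕ} {p p' : Fin (k + 1) → ℝ}
    (hp : p (Fin.last k) = 0) (hp' : p' (Fin.last k) = 0) : S.pol k (S.Eint k p) = S.pol k (S.Eint k p') := by
  rw [hD.d213 k p p' hp hp']

/-- `beta_abs_le_of_conclusions` with its constant NAMED: along every run defined by (0.20) with 0 < g_k ≦ γ (k ≤ K), at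
every step j + 1 ≤ K and every last coupling s ∈ [0, γ], |β_{j+1}(g₀, …, g_{j−1}, s)| ≦ β′ with β′ = `B12Sec2to5.betaPrime510 4
(C510·E₀) δ₁` — the letter under which the tree's `B12Sec2to5.betaUpper_of_decay510` ∕ `Step.BetaUpper` consumers read the
§5 bound (row-D4 owner's display request S-1).  Definitional unfolding of `betaPrime510`; nothing of [I] asserted.
[cite: Balaban1987RG1, (5.10) p.293 with (5.42) p.297 and p.264 («uniformly bounded»)] -/
theorem abs_lastSection_le_betaPrime510 {S : Setting} (hD : Definitions S) (hC : Conclusions S) {P : B12.RunParams}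
    (hP : RunHyp S P) {j : ℕ} (hj : j + 1 ≤ P.K) {s : ℝ} (hs : s ∈ Set.Icc (0 : ℝ) S.γ) {μ ν : Fin 4} (hμν : μ ≠ ν) :
    |lastSection S P j s| ≤ B12Sec2to5.betaPrime510 4 (S.C510 * S.E₀) S.δ₁ := by
  unfold B12Sec2to5.betaPrime510
  exact beta_abs_le_of_conclusions hD hC hP hj hs hμν

end B12BetaAsPrinted

end

end Literature.MathematicalPhysics.QuantumFieldTheory.Balaban1983to89
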